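import Summits.CriticalPhenomena.SAWScalingLimit.Theorems.SAWDevelopingMapHexConjectureKPDefs
import HarnessLib

/-!
# Crux `HexConjecture` (stmt-CriticalPhenomena-0808), line `root-locality-replaces-loewner`:
splitting a triangle walk at a renewal crossing (Krachun–Panagiotis, Lemma 3.1)

Landing target:
`Summits/CriticalPhenomena/SAWScalingLimit/Theorems/SAWDevelopingMapHexConjectureKPRenewalSplit.lean`
(`--supports stmt-CriticalPhenomena-0808`; registered stub `stub_kp_renewal_split`).

Krachun–Panagiotis, proof of Lemma 3.1 (arXiv:2310.17299, p. 9, Fig. 3): "Consider γ ∈ D(Tria_{2k+1})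
such that `i` is a renewal time.  Let `x` be the mid-edge in the line `i + 1/2 + e^{2πi/3}ℝ` that γ
visits.  The sub-walk of γ from `x` until its endpoint is (the rotation and translation of) a bridge
within Strip_{k−i}; whilst the sub-walk from `0` to `x` lies in the triangle `T_{k,i}`."

In the coordinate model `HV` (`…KPDefs.lean`): a walk `P ∈ rightWalks k` of the triangle `T_k` to its
right side, crossing the slanted line `slev = i ∣ i+1` exactly once (`crossCount i P = 1`, `i ≤ k`),
is cut at that crossing.  Since `slev` starts at `0 ≤ i` (at `w`, `O`), ends at `k + 1` (outer end of
the final right dart) and changes by at most one along an edge (`slev_sub_of_adj`), the first vertex of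
`slev ≥ i+1` is entered through the unique crossing, which is therefore an upward right dart
`(x₀,x₁,false) → (x₀,x₁,true)`, `x₀ + x₁ = i`; every earlier vertex has `slev ≤ i` and (one crossing
only) every later vertex has `slev ≥ i+1`.  The PREFIX up to the crossing is a walk of the off-centred
triangle `triV₂ k i` exiting through its right side at that dart; the SUFFIX from the crossing cell on,
pulled back by the attachment automorphism `attach x₀ x₁` (which places the root dart `(w, O)` onto the
crossing dart), is a walk of the strip `stripV (k-i) (3k)` ending on its far side `β` (a bridge of
width `k - i`); the lengths add up and the two pieces glue back to `P`.  This is the registered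
sub-goal `stub_kp_renewal_split` (the injection behind `Σ_γ x_c^{ℓ(γ)} 1_{i renewal} ≤ Δ_{k,i} B_{k-i}`).
Sources: Krachun–Panagiotis (arXiv:2310.17299) §3.1, Lemma 3.1; Duminil-Copin–Smirnov 2012 §3
(strips, bridges); Glazman–Manolescu 2020 §4.1 (the triangle `T_L`).
-/

noncomputable section

open Finset
open Literature.Probability.RandomPlanarGeometry.SAW Literature.Probability.RandomPlanarGeometry.SAW.HV

namespace Summit.CriticalPhenomena.SAWScalingLimit.Theorems.HexConjecture.RootLocality

/-! ### Small list and coordinate helpers -/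

/-- The last entry of the prefix of length `t + 1` is the `t`-th entry. [folklore] -/
private theorem rsplit_getLast?_take_succ {α : Type*} {l : List α} {t : ℕ} (h : t < l.length) :
    (l.take (t + 1)).getLast? = some l[t] := by
  rw [List.take_succ_eq_append_getElem h, List.getLast?_concat]

/-- Two distinct consecutive pairs of a vertex list with slanted levels `{i, i+1}` are two crossings
of the line `slev = i ∣ i+1`. [cite: KrachunPanagiotis2026, §3.1] -/
private theorem rsplit_two_le_crossCount (i : ℤ) (P : List HV) {s t : ℕ} (hst : s < t)
    (ht : t + 1 < P.length)
    (hs' : (slev (P[s]'(by omega)) = i ∧ slev (P[s + 1]'(by omega)) = i + 1) ∨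
      (slev (P[s]'(by omega)) = i + 1 ∧ slev (P[s + 1]'(by omega)) = i))
    (ht' : (slev (P[t]'(by omega)) = i ∧ slev P[t + 1] = i + 1) ∨
      (slev (P[t]'(by omega)) = i + 1 ∧ slev P[t + 1] = i)) :
    2 ≤ crossCount i P := by
  unfold crossCount
  have hlen : (P.zip P.tail).length = P.length - 1 := by
    rw [List.length_zip, List.length_tail]; omega
  have eLs : (P.zip P.tail)[s]'(by omega) = (P[s]'(by omega), P[s + 1]'(by omega)) := by simp
  have eLt : (P.zip P.tail)[t]'(by omega) = (P[t]'(by omega), P[t + 1]) := by simp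
  have key : ∀ (l₁ l₂ : List (HV × HV)) (q : HV × HV → Bool),
      (P.zip P.tail)[s]'(by omega) ∈ l₁ → (P.zip P.tail)[t]'(by omega) ∈ l₂ →
      q ((P.zip P.tail)[s]'(by omega)) = true → q ((P.zip P.tail)[t]'(by omega)) = true →
      2 ≤ (l₁.filter q ++ l₂.filter q).length := by
    intro l₁ l₂ q h1 h2 q1 q2
    rw [List.length_append]
    have := List.length_pos_of_mem (List.mem_filter.2 ⟨h1, q1⟩)
    have := List.length_pos_of_mem (List.mem_filter.2 ⟨h2, q2⟩)
    omega
  rw [← List.take_append_drop t (P.zip P.tail), List.filter_append]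
  apply key
  · exact List.mem_take_iff_getElem.2 ⟨s, by omega, rfl⟩
  · exact List.mem_drop_iff_getElem.2 ⟨0, by omega, rfl⟩
  · simpa [eLs] using hs'
  · simpa [eLt] using ht'

/-- The only edges of `ℍ` raising the slanted level (by one) are the right darts
`(x₀,x₁,false) → (x₀,x₁,true)`. [cite: KrachunPanagiotis2026, §3.1] -/
private theorem rsplit_eq_of_adj_of_slev {u v : HV} (h : hvGraph.Adj u v)
    (hs : slev v = slev u + 1) : u = (u.1, u.2.1, false) ∧ v = (u.1, u.2.1, true) := by
  obtain ⟨a, b, c⟩ := u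
  obtain ⟨a', b', c'⟩ := v
  cases c <;> cases c' <;> simp [hvGraph_adj, AdjRel, bit] at h hs ⊢ <;> omega

/-- The inverse of the attachment automorphism in coordinates:
`(attach x₀ x₁)⁻¹ (v₀, v₁, b) = (x₁ - v₁, slev v - x₀ - x₁ - 1, ¬b)`. [cite: KrachunPanagiotis2026, §3.2] -/
private theorem rsplit_attach_symm_apply (x₀ x₁ : ℤ) (v : HV) :
    (attach x₀ x₁).symm v = (x₁ - v.2.1, v.1 + v.2.1 + bit v - x₀ - x₁ - 1, !v.2.2) := by
  rw [RelIso.symm_apply_eq, attach_apply]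
  obtain ⟨a, b, c⟩ := v
  cases c <;> simp [bit] <;> omega

/-- A cell of `T_k` beyond the renewal line `slev = i ∣ i+1` (`slev ≥ i+1`), pulled back by the
attachment at a crossing cell `(x₀, x₁)` (`x₀ + x₁ = i`, `0 ≤ x₁ ≤ 2k`), lies in the strip
`S_{k-i, 3k}` ("the sub-walk of γ from x until its endpoint is a bridge within Strip_{k−i}").
[cite: KrachunPanagiotis2026, proof of Lemma 3.1] -/
private theorem rsplit_symm_mem_stripV {k i : ℕ} {x₀ x₁ : ℤ} {c : HV} (hik : i ≤ k)
    (hx : x₀ + x₁ = i) (hx₁ : 0 ≤ x₁) (hx₁' : x₁ ≤ 2 * k) (hc : c ∈ triV k)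
    (hs : (i : ℤ) + 1 ≤ slev c) : (attach x₀ x₁).symm c ∈ stripV (k - i) (3 * k) := by
  rw [rsplit_attach_symm_apply, mem_stripV_iff]
  rw [mem_triV_iff] at hc
  obtain ⟨a, b, d⟩ := c
  push_cast [Nat.cast_sub hik]
  cases d <;> simp [bit, lev] at hs hc ⊢ <;> omega

/-- The final dart of a vertex list with at least two entries, by indices. [folklore] -/
private theorem rsplit_finalDart_eq {P : List HV} (h : 2 ≤ P.length) :
    finalDart P = (P[P.length - 2], P[P.length - 1]) := by
  unfold finalDart
  rw [List.getLast?_dropLast, if_neg (by omega), List.getLast?_eq_getElem?,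
    List.getElem?_eq_getElem (show P.length - 2 < P.length by omega),
    List.getElem?_eq_getElem (show P.length - 1 < P.length by omega)]
  rfl

/-- The final dart of a mapped suffix `(P.drop d).map f` containing the last two entries.
[folklore] -/
private theorem rsplit_finalDart_map_drop {P : List HV} (f : HV → HV) {d : ℕ}
    (h : d + 2 ≤ P.length) :
    finalDart ((P.drop d).map f) = (f P[P.length - 2], f P[P.length - 1]) := by
  unfold finalDart
  rw [← List.map_dropLast, List.getLast?_map, List.getLast?_map,
    List.dropLast_drop_eq_drop_dropLast, List.getLast?_drop, List.getLast?_drop,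
    if_neg (show ¬ P.dropLast.length ≤ d by rw [List.length_dropLast]; omega),
    if_neg (show ¬ P.length ≤ d by omega), List.getLast?_dropLast, if_neg (by omega),
    List.getLast?_eq_getElem?, List.getElem?_eq_getElem (show P.length - 2 < P.length by omega),
    List.getElem?_eq_getElem (show P.length - 1 < P.length by omega)]
  rfl

/-! ### The splitting -/

/-- **Registered sub-goal `stub_kp_renewal_split`** (crux item stmt-CriticalPhenomena-0808, line
`root-locality-replaces-loewner`; Krachun–Panagiotis, proof of Lemma 3.1): a walk `P` of the triangle
`T_k` to its right side which crosses the line `slev = i ∣ i+1` (`i ≤ k`) exactly once splits at that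
crossing — an upward right dart `((x₀,x₁,false), (x₀,x₁,true))`, `x₀ + x₁ = i`, `x₁ ≥ 0` — into a
PREFIX `Q`, a walk of the off-centred triangle `T_{k,i} = triV₂ k i` exiting through its right side at
that dart, and a SUFFIX `S` which, normalised by the inverse of the attachment automorphism
`attach x₀ x₁`, is a walk of the strip `S_{k-i,3k}` to its far side `β` (a bridge of width `k-i`);
`ℓ(Q) + ℓ(S) = ℓ(P)` and `P = Q ++ ((S.map (attach x₀ x₁)).drop 2)`.
[cite: KrachunPanagiotis2026, Lemma 3.1 (proof, Fig. 3)] -/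
theorem stub_kp_renewal_split : ∀ (k : ℕ) (P : List Literature.Probability.RandomPlanarGeometry.SAW.HV), P ∈ rightWalks k → ∀ (i : ℕ), i ≤ k → crossCount (i : ℤ) P = 1 → ∃ (Q S : List Literature.Probability.RandomPlanarGeometry.SAW.HV) (x₀ x₁ : ℤ), x₀ + x₁ = i ∧ 0 ≤ x₁ ∧ Q ∈ (Literature.Probability.RandomPlanarGeometry.SAW.HV.midWalks (triV₂ k i)).filter (fun Q => Literature.Probability.RandomPlanarGeometry.SAW.HV.IsRightDart i (Literature.Probability.RandomPlanarGeometry.SAW.HV.finalDart Q)) ∧ Literature.Probability.RandomPlanarGeometry.SAW.HV.finalDart Q = ((x₀, x₁, false), (x₀, x₁, true)) ∧ S ∈ (Literature.Probability.RandomPlanarGeometry.SAW.HV.midWalks (Literature.Probability.RandomPlanarGeometry.SAW.HV.stripV (k - i) (3 * k))).filter (fun S => Literature.Probability.RandomPlanarGeometry.SAW.HV.IsBetaDart (k - i) (Literature.Probability.RandomPlanarGeometry.SAW.HV.finalDart S)) ∧ Literature.Probability.RandomPlanarGeometry.SAW.HV.mwLen Q + Literature.Probability.RandomPlanarGeometry.SAW.HV.mwLen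 S = Literature.Probability.RandomPlanarGeometry.SAW.HV.mwLen P ∧ P = Q ++ ((S.map (attach x₀ x₁)).drop 2) := by
  classical
  intro k P hP i hik hcross
  rw [rightWalks, mem_filter, mem_midWalks_iff] at hP
  obtain ⟨hW, hR⟩ := hP
  have hc := hW.1
  have hh := hW.2.1
  have ht := hW.2.2.1
  have hV := hW.2.2.2.1
  have hnd := hW.2.2.2.2.1
  have hne := hW.2.2.2.2.2
  have hn2 : 2 ≤ P.length := hW.two_le_length
  -- the first two entries `w`, `O`
  have hP0 : P[0]'(by omega) = wOut := by
    rw [List.head?_eq_getElem?] at hh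
    exact (List.getElem?_eq_some_iff.1 hh).2
  have hP1 : P[1]'(by omega) = hvOrigin := by
    rw [List.head?_tail] at ht
    exact (List.getElem?_eq_some_iff.1 ht).2
  -- the final right dart `((a,b,false), (a,b,true))`, `a + b = k`
  rw [rsplit_finalDart_eq hn2] at hR
  obtain ⟨a, b, hab, hA, hB⟩ : ∃ a b : ℤ, a + b = k ∧
      P[P.length - 2]'(by omega) = (a, b, false) ∧ P[P.length - 1]'(by omega) = (a, b, true) :=
    ⟨_, _, hR.1, Prod.ext rfl (Prod.ext rfl hR.2.1), hR.2.2⟩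
  have hslev_end : slev (P[P.length - 1]'(by omega)) = k + 1 := by
    rw [hB, slev_mk, bit_true]; omega
  -- one step changes `slev` by at most one
  have hstep : ∀ (t s : ℕ) (hs : s < P.length) (_e : s = t + 1),
      (slev P[s] = slev (P[t]'(by omega)) ∨ slev P[s] = slev (P[t]'(by omega)) + 1 ∨
        slev P[s] = slev (P[t]'(by omega)) - 1) := by
    rintro t s hs rfl
    exact slev_sub_of_adj (hc.getElem t hs)
  have hadj : ∀ (t s : ℕ) (hs : s < P.length) (_e : s = t + 1),
      hvGraph.Adj (P[t]'(by omega)) P[s] := by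
    rintro t s hs rfl
    exact hc.getElem t hs
  -- inner vertices by index
  have hli : (inner P).length = P.length - 2 := by
    rw [HV.inner, List.length_dropLast, List.length_tail]; omega
  have hinnerP : ∀ (s : ℕ) (hs : s < (inner P).length),
      (inner P)[s] = P[s + 1]'(by omega) := by
    intro s hs; simp [HV.inner]
  have hinner : ∀ (s : ℕ) (hs : s + 2 < P.length), P[s + 1] ∈ triV k := by
    intro s hs
    rw [← hinnerP s (by omega)]
    exact hV _ (List.getElem_mem _)
  -- the crossing index: the first vertex beyond the line
  have hex : ∃ t, ∃ h : t < P.length, (i : ℤ) + 1 ≤ slev P[t] :=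
    ⟨P.length - 1, by omega, by rw [hslev_end]; omega⟩
  obtain ⟨j, ⟨hjn, hjs⟩, hjmin⟩ : ∃ j, (∃ h : j < P.length, (i : ℤ) + 1 ≤ slev P[j]) ∧
      ∀ t < j, ¬ ∃ h : t < P.length, (i : ℤ) + 1 ≤ slev P[t] :=
    ⟨Nat.find hex, Nat.find_spec hex, fun t ht => Nat.find_min hex ht⟩
  have hlow : ∀ (t : ℕ) (ht : t < P.length), t < j → slev P[t] ≤ i := by
    intro t ht htj
    by_contra hcon
    exact hjmin t htj ⟨ht, by omega⟩
  have hj2 : 2 ≤ j := by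
    by_contra hcon
    have : j = 0 ∨ j = 1 := by omega
    rcases this with rfl | rfl
    · rw [hP0, slev_wOut] at hjs; omega
    · rw [hP1, slev_hvOrigin] at hjs; omega
  obtain ⟨m, rfl⟩ : ∃ m, j = m + 1 + 1 := ⟨j - 2, by omega⟩
  -- the crossing edge is an upward right dart `(x₀,x₁,false) → (x₀,x₁,true)`
  have hsj : slev (P[m + 1 + 1]'hjn) = i + 1 ∧ slev (P[m + 1]'(by omega)) = i := by
    have h1 := hlow (m + 1) (by omega) (by omega)
    rcases hstep (m + 1) (m + 1 + 1) hjn rfl with h | h | h <;> omega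
  obtain ⟨x₀, x₁, hc0, hc1⟩ : ∃ x₀ x₁ : ℤ, P[m + 1]'(by omega) = (x₀, x₁, false) ∧
      P[m + 1 + 1]'hjn = (x₀, x₁, true) :=
    ⟨_, _, rsplit_eq_of_adj_of_slev (hadj (m + 1) (m + 1 + 1) hjn rfl) (by omega)⟩
  have hx : x₀ + x₁ = i := by
    have := hsj.2; rw [hc0, slev_mk, bit_false] at this; omega
  have hxtri : (x₀, x₁, false) ∈ triV k := by rw [← hc0]; exact hinner m (by omega)
  rw [mem_triV_iff] at hxtri
  simp only [bit_false, add_zero] at hxtri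
  -- beyond the crossing the walk stays beyond the line (one crossing only)
  have hhigh : ∀ (t : ℕ), m + 1 + 1 ≤ t → ∀ (ht : t < P.length),
      (i : ℤ) + 1 ≤ slev P[t] := by
    intro t hmt
    induction t, hmt using Nat.le_induction with
    | base => intro ht; exact hjs
    | succ t hmt ih =>
      intro ht
      have h1 := ih (by omega)
      by_contra hcon
      have h2 : slev P[t + 1] = i ∧ slev (P[t]'(by omega)) = i + 1 := by
        rcases hstep t (t + 1) ht rfl with h | h | h <;> omega
      have := rsplit_two_le_crossCount (i : ℤ) P (show m + 1 < t by omega) ht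
        (Or.inl ⟨hsj.2, hsj.1⟩) (Or.inr ⟨h2.2, h2.1⟩)
      omega
  -- the normalising automorphism and the two pieces
  set ψ : hvGraph ≃g hvGraph := (attach x₀ x₁).symm with hψ
  have hψ0 : ψ (x₀, x₁, false) = wOut := by rw [hψ, RelIso.symm_apply_eq, attach_wOut]
  have hψ1 : ψ (x₀, x₁, true) = hvOrigin := by
    rw [hψ, RelIso.symm_apply_eq, attach_hvOrigin]
  have hQeq : P.take (m + 1 + 1 + 1) =
      P.take (m + 1) ++ [P[m + 1]'(by omega)] ++ [P[m + 1 + 1]'hjn] := by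
    rw [List.take_succ_eq_append_getElem hjn,
      List.take_succ_eq_append_getElem (show m + 1 < P.length by omega)]
  have hQlen : (P.take (m + 1 + 1 + 1)).length = m + 1 + 1 + 1 := by
    rw [List.length_take]; omega
  have hSlen : ((P.drop (m + 1)).map ψ).length = P.length - (m + 1) := by
    rw [List.length_map, List.length_drop]
  have hiQ : inner (P.take (m + 1 + 1 + 1)) = (inner P).take (m + 1) := by
    rw [HV.inner, HV.inner, List.tail_take_eq_take_tail, List.dropLast_take_eq_take_dropLast]
    simp only [Nat.add_sub_cancel]
  have hiS : inner (P.drop (m + 1)) = (inner P).drop (m + 1) := by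
    rw [HV.inner, HV.inner, List.tail_drop, List.dropLast_drop_eq_drop_dropLast,
      ← List.tail_dropLast, ← List.drop_one, List.drop_drop, Nat.add_comm 1 (m + 1)]
  have hfdQ : finalDart (P.take (m + 1 + 1 + 1)) = ((x₀, x₁, false), (x₀, x₁, true)) := by
    unfold finalDart
    rw [hQeq]
    simp [hc0, hc1]
  have hfdS := rsplit_finalDart_map_drop ψ (P := P) (d := m + 1) (by omega)
  refine ⟨P.take (m + 1 + 1 + 1), (P.drop (m + 1)).map ψ, x₀, x₁, hx, hxtri.1,
    ?_, ?_, ?_, ?_, ?_⟩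
  · -- the prefix is a right-exiting walk of `T_{k,i}`
    rw [mem_filter, mem_midWalks_iff, hfdQ]
    refine ⟨⟨hc.take _, ?_, ?_, ?_, ?_, ?_⟩, hx, rfl, rfl⟩
    · rw [List.head?_take, if_neg (by omega), hh]
    · rw [List.tail_take_eq_take_tail, List.head?_take, if_neg (by omega), ht]
    · intro x hxQ
      rw [hiQ, List.mem_take_iff_getElem] at hxQ
      obtain ⟨s, hs, rfl⟩ := hxQ
      rw [hinnerP s (by omega)]
      have h1 := hinner s (by omega)
      have h2 := hlow (s + 1) (by omega) (by omega)
      rw [mem_triV_iff] at h1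
      rw [mem_triV₂_iff]
      exact ⟨h1.1, h1.2.1, h2, h1.2.2⟩
    · rw [hiQ]; exact List.Nodup.sublist (List.take_sublist _ _) hnd
    · rw [hQeq]
      simp only [List.dropLast_concat, List.getLast?_concat]
      rw [rsplit_getLast?_take_succ (show m < P.length by omega)]
      intro h
      rw [Option.some_inj] at h
      have h1 := hlow m (by omega) (by omega)
      have h2 := hsj.1
      rw [h] at h1
      omega
  · exact hfdQ
  · -- the normalised suffix is a walk of `S_{k-i,3k}` to `β`
    rw [mem_filter, mem_midWalks_iff, hfdS]
    refine ⟨⟨?_, ?_, ?_, ?_, ?_, ?_⟩, ?_⟩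
    · rw [List.isChain_map]; exact (hc.drop _).imp fun a b h => ψ.map_rel_iff.2 h
    · rw [List.head?_map, List.head?_drop,
        List.getElem?_eq_getElem (show m + 1 < P.length by omega), hc0, Option.map_some, hψ0]
    · rw [← List.map_tail, List.tail_drop, List.head?_map, List.head?_drop,
        List.getElem?_eq_getElem hjn, hc1, Option.map_some, hψ1]
    · intro y hy
      rw [inner_map, hiS, List.mem_map] at hy
      obtain ⟨c, hcmem, rfl⟩ := hy
      rw [List.mem_drop_iff_getElem] at hcmem
      obtain ⟨s, hs, rfl⟩ := hcmem
      rw [hinnerP (m + 1 + s) (by omega)]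
      exact rsplit_symm_mem_stripV hik hx hxtri.1 (by omega) (hinner (m + 1 + s) (by omega))
        (hhigh (m + 1 + s + 1) (by omega) (by omega))
    · rw [inner_map, hiS]
      exact (List.Nodup.sublist (List.drop_sublist _ _) hnd).map ψ.injective
    · rw [← List.map_dropLast, ← List.map_dropLast, List.getLast?_map, List.getLast?_map]
      intro h
      have h' := Option.map_injective ψ.injective h
      rw [List.dropLast_drop_eq_drop_dropLast, List.dropLast_drop_eq_drop_dropLast,
        List.getLast?_drop, List.getLast?_drop, if_neg (show ¬ P.length ≤ m + 1 by omega)] at h'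
      split_ifs at h' with hcase
      · rw [List.getLast?_eq_getElem?,
          List.getElem?_eq_getElem (show P.length - 1 < P.length by omega)] at h'
        exact absurd h' (by simp)
      · exact hne h'
    · -- the final dart is a `β` dart of height `k - i`
      rw [hA, hB, hψ, rsplit_attach_symm_apply, rsplit_attach_symm_apply]
      simp only [bit_false, bit_true, Bool.not_false, Bool.not_true]
      refine ⟨?_, rfl, ?_⟩
      · dsimp only; omega
      · dsimp only
        refine Prod.ext rfl (Prod.ext ?_ rfl)
        dsimp only; omega
  · -- lengths add up
    simp only [mwLen, hQlen, hSlen]; omega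
  · -- gluing back
    have hSmap : ((P.drop (m + 1)).map ψ).map (attach x₀ x₁) = P.drop (m + 1) := by
      rw [List.map_map]
      exact List.map_id'' (fun v => (attach x₀ x₁).apply_symm_apply v) _
    rw [hSmap, List.drop_drop]
    exact (List.take_append_drop _ P).symm

end Summit.CriticalPhenomena.SAWScalingLimit.Theorems.HexConjecture.RootLocality

end
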